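import Mathlib
import Summits.Ventures.PercRepro2.TwoSepReal

/-!
# Gluing at a 2-separator, IV: the mark `b` alone behind a separator `{c, d}` — the typed
one-far-`b` rule at a 2-separator (blind cell PercRepro2, mine-2 g46, 2026-08-29;
`conjectures/MINE-2.md` M2-95)

CLASS (`Sep2FarB`): the support graph `z ∪ F` splits into a root side `VH ∋ o, a₁, a₂, a₃` and a far
side `VL ∋ b` meeting exactly in the two vertices `c, d` (marks may lie in `{c, d}`; `b` may not), no
typed edge inside both sides.  The state of a copy is a function of its ROOT-SIDE DATA — the thirteen
connections inside `VH` among `o, a₁, a₂, a₃, c, d` that the kernel can see (`rootData2B`) — and of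
its FAR PATTERN `(1[c ↔ d], 1[c ↔ b], 1[d ↔ b])` read inside `VL` (`fp`): the far identification
`c ↔ d` can merge two root-side clusters, and `b` hangs from the root side through `c` or `d`
(`st_eq_glued2B`, by `conn_side2` / `conn_cross2`).  Sorting the copies by their pattern triple,

  **`typedCount F z τ K₃ = (Σ_p farCount(p) · rootCount(p)) · (inert count)`**

(`typedCount_eq_sep2FarB`), and row 2′TRI on the class follows once every real `S₃`-orbit sum
of the root counts is nonnegative (`typedCount_nonneg_of_sep2FarB`) — the same template as the
`a₃` rule of `TwoSepFarA3.lean`, with the cross formula on the `b`-coordinates.  The cut-vertex rule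
`typedCount_eq_cutFarB` is the case `c = d`.  Own work; standard axioms.
-/

namespace Summit.Ventures.PercRepro2

open UnionCluster

namespace CovForm

namespace RootBridge

open OneTyped TypedA3 Untouched TypedFactor Separated

/-! ## The root-side data and the glued state -/

section States

/-- The root-side data of a copy at a 2-separator `{c, d}` when `b` is the far mark: the
connections inside the root side among the root-side marks and the separator vertices that the
glued state depends on. -/
structure RootData2B where
  /-- `a₂ ↔ a₁` -/
  q' : Bool
  /-- `a₁ ↔ o` -/
  Lo : Bool
  /-- `a₂ ↔ o` -/
  Ho : Bool
  /-- `a₁ ↔ a₃` -/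
  L3 : Bool
  /-- `a₂ ↔ a₃` -/
  H3 : Bool
  /-- `a₁ ↔ c` -/
  Lc : Bool
  /-- `a₁ ↔ d` -/
  Ld : Bool
  /-- `a₂ ↔ c` -/
  Hc : Bool
  /-- `a₂ ↔ d` -/
  Hd : Bool
  /-- `o ↔ c` -/
  oc : Bool
  /-- `o ↔ d` -/
  od : Bool
  /-- `a₃ ↔ c` -/
  tc : Bool
  /-- `a₃ ↔ d` -/
  td : Bool

/-- **The glued state**: the root-side data `h` glued with the far pattern `p = (g, fc, fd)`.  A
root-side connection `r ↔ u` holds directly, or through `c`, the far identification `g` and `d`, or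
the other way round; `b` is reached through `c` when `fc`, through `d` when `fd`. -/
def glued2B (h : RootData2B) (p : FP) : St :=
  (h.q' || ((h.Hc && (p.1 && h.Ld)) || (h.Hd && (p.1 && h.Lc))),
   h.Lo || ((h.Lc && (p.1 && h.od)) || (h.Ld && (p.1 && h.oc))),
   h.Ho || ((h.Hc && (p.1 && h.od)) || (h.Hd && (p.1 && h.oc))),
   (h.Lc && p.2.1) || (h.Ld && p.2.2),
   (h.Hc && p.2.1) || (h.Hd && p.2.2),
   h.L3 || ((h.Lc && (p.1 && h.td)) || (h.Ld && (p.1 && h.tc))),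
   h.H3 || ((h.Hc && (p.1 && h.td)) || (h.Hd && (p.1 && h.tc))))

end States

/-! ## The class, the states of the support and the rule -/

section Main

open Classical

variable {V : Type*} {E : Type*} [Fintype E] [DecidableEq E] {R : Type*} [Field R]
  [LinearOrder R] [IsStrictOrderedRing R]
variable (ends : E → Sym2 V) (o a₁ a₂ a₃ b c d : V)

/-- The root-side data of a configuration (read on the root-side restriction). -/
noncomputable def rootData2B (y : Config E) : RootData2B :=
  ⟨decide (Conn ends y a₂ a₁), decide (Conn ends y a₁ o), decide (Conn ends y a₂ o),
    decide (Conn ends y a₁ a₃), decide (Conn ends y a₂ a₃),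
    decide (Conn ends y a₁ c), decide (Conn ends y a₁ d), decide (Conn ends y a₂ c),
    decide (Conn ends y a₂ d), decide (Conn ends y o c), decide (Conn ends y o d),
    decide (Conn ends y a₃ c), decide (Conn ends y a₃ d)⟩

/-- **`b` alone behind the 2-separator `{c, d}`**: the support graph `z ∪ F` splits into a root
side `VH ∋ o, a₁, a₂, a₃` and a far side `VL ∋ b` meeting exactly in `{c, d}`, no typed edge inside
both sides, `b` not a separator vertex. -/
structure Sep2FarB (VL VH : Set V) (F : Finset E) (z : Config E) : Prop where
  split : ∀ e, zF F z e = true → e ∈ within ends VL ∨ e ∈ within ends VH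
  cap : ∀ t, t ∈ VL → t ∈ VH → t = c ∨ t = d
  noloop : ∀ e ∈ F, ¬ (e ∈ within ends VL ∧ e ∈ within ends VH)
  cL : c ∈ VL
  cH : c ∈ VH
  dL : d ∈ VL
  dH : d ∈ VH
  oH : o ∈ VH
  a1H : a₁ ∈ VH
  a2H : a₂ ∈ VH
  a3H : a₃ ∈ VH
  bL : b ∈ VL
  bc : b ≠ c
  bd : b ≠ d

omit [Fintype E] [LinearOrder R] [IsStrictOrderedRing R] in
/-- A configuration below `z ∪ F` has its open edges within a side. -/
lemma Sep2FarB.split_of_le {VL VH : Set V} {F : Finset E} {z : Config E}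
    (h : Sep2FarB ends o a₁ a₂ a₃ b c d VL VH F z) {x : Config E} (hx : x ≤ zF F z) :
    ∀ e, x e = true → e ∈ within ends VL ∨ e ∈ within ends VH := fun e he =>
  h.split e (by have := hx e; rw [he] at this; exact Bool.eq_true_of_true_le this)

omit [Fintype E] [DecidableEq E] in
/-- Connection is symmetric, as a decided Boolean. -/
lemma decide_conn_symmB (y : Config E) (u v : V) :
    decide (Conn ends y u v) = decide (Conn ends y v u) :=
  decide_eq_decide.mpr ⟨conn_symm, conn_symm⟩

omit [Fintype E] [LinearOrder R] [IsStrictOrderedRing R] in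
/-- **The state of a copy of the support**: the root-side data glued with the far pattern. -/
theorem st_eq_glued2B {VL VH : Set V} {F : Finset E} {z : Config E}
    (h : Sep2FarB ends o a₁ a₂ a₃ b c d VL VH F z) {x : Config E}
    (hx : ∀ e, e ∉ F → x e = z e) :
    st ends o a₁ a₂ a₃ b x =
      glued2B (rootData2B ends o a₁ a₂ a₃ c d (withinRestr ends VH x))
        (fp ends c d b (withinRestr ends VL x)) := by
  have hsp := Sep2FarB.split_of_le ends o a₁ a₂ a₃ b c d h (le_zF hx)
  have hsp' : ∀ e, x e = true → e ∈ within ends VH ∨ e ∈ within ends VL := fun e he =>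
    (hsp e he).symm
  have hcap' : ∀ t, t ∈ VH → t ∈ VL → t = c ∨ t = d := fun t h1 h2 => h.cap t h2 h1
  set y := withinRestr ends VH x with hy
  set y' := withinRestr ends VL x with hy'
  have e1 : Conn ends x a₂ a₁ ↔ (Conn ends y a₂ a₁ ∨
      (Conn ends y a₂ c ∧ Conn ends y' c d ∧ Conn ends y d a₁) ∨
      (Conn ends y a₂ d ∧ Conn ends y' c d ∧ Conn ends y c a₁)) :=
    conn_side2 ends hsp' hcap' h.a2H h.a1H
  have e2 : Conn ends x a₁ o ↔ (Conn ends y a₁ o ∨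
      (Conn ends y a₁ c ∧ Conn ends y' c d ∧ Conn ends y d o) ∨
      (Conn ends y a₁ d ∧ Conn ends y' c d ∧ Conn ends y c o)) :=
    conn_side2 ends hsp' hcap' h.a1H h.oH
  have e3 : Conn ends x a₂ o ↔ (Conn ends y a₂ o ∨
      (Conn ends y a₂ c ∧ Conn ends y' c d ∧ Conn ends y d o) ∨
      (Conn ends y a₂ d ∧ Conn ends y' c d ∧ Conn ends y c o)) :=
    conn_side2 ends hsp' hcap' h.a2H h.oH
  have e4 : Conn ends x a₁ b ↔ ((Conn ends y a₁ c ∧ Conn ends y' c b) ∨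
      (Conn ends y a₁ d ∧ Conn ends y' d b)) :=
    conn_cross2 ends hsp' hcap' h.a1H h.bL h.bc h.bd
  have e5 : Conn ends x a₂ b ↔ ((Conn ends y a₂ c ∧ Conn ends y' c b) ∨
      (Conn ends y a₂ d ∧ Conn ends y' d b)) :=
    conn_cross2 ends hsp' hcap' h.a2H h.bL h.bc h.bd
  have e6 : Conn ends x a₁ a₃ ↔ (Conn ends y a₁ a₃ ∨
      (Conn ends y a₁ c ∧ Conn ends y' c d ∧ Conn ends y d a₃) ∨
      (Conn ends y a₁ d ∧ Conn ends y' c d ∧ Conn ends y c a₃)) :=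
    conn_side2 ends hsp' hcap' h.a1H h.a3H
  have e7 : Conn ends x a₂ a₃ ↔ (Conn ends y a₂ a₃ ∨
      (Conn ends y a₂ c ∧ Conn ends y' c d ∧ Conn ends y d a₃) ∨
      (Conn ends y a₂ d ∧ Conn ends y' c d ∧ Conn ends y c a₃)) :=
    conn_side2 ends hsp' hcap' h.a2H h.a3H
  unfold st glued2B rootData2B fp
  rw [decide_eq_decide.mpr e1, decide_eq_decide.mpr e2, decide_eq_decide.mpr e3,
    decide_eq_decide.mpr e4, decide_eq_decide.mpr e5, decide_eq_decide.mpr e6,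
    decide_eq_decide.mpr e7]
  · simp only [Bool.decide_or, Bool.decide_and]
    rw [decide_conn_symmB ends y d a₁, decide_conn_symmB ends y c a₁, decide_conn_symmB ends y d o,
      decide_conn_symmB ends y c o, decide_conn_symmB ends y d a₃, decide_conn_symmB ends y c a₃]
  all_goals infer_instance

/-- The root-side kernel of a fixed pattern triple `p`: the kernel on the glued states of the three
copies, read on the root-side restriction. -/
noncomputable def rootK2B (VH : Set V) (p : Pat3) : Config E → Config E → Config E → R :=
  fun x y w => ((KB (glued2B (rootData2B ends o a₁ a₂ a₃ c d (withinRestr ends VH x)) p.1)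
    (glued2B (rootData2B ends o a₁ a₂ a₃ c d (withinRestr ends VH y)) p.2.1)
    (glued2B (rootData2B ends o a₁ a₂ a₃ c d (withinRestr ends VH w)) p.2.2) : ℤ) : R)

omit [Fintype E] [LinearOrder R] [IsStrictOrderedRing R] in
/-- **`K₃` on the support** when `b` alone sits beyond `{c, d}`: the pattern-triple form. -/
theorem K3_eq_sep2FarB {VL VH : Set V} {F : Finset E} {z : Config E}
    (h : Sep2FarB ends o a₁ a₂ a₃ b c d VL VH F z) {x y w : Config E}
    (hx : ∀ e, e ∉ F → x e = z e) (hy : ∀ e, e ∉ F → y e = z e) (hw : ∀ e, e ∉ F → w e = z e) :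
    (K3 ends o a₁ a₂ a₃ b x y w : R) =
      ∑ p : Pat3, farK ends c d b VL p (restr (sideF ends VL F) z x) (restr (sideF ends VL F) z y)
          (restr (sideF ends VL F) z w) *
        rootK2B ends o a₁ a₂ a₃ c d VH p (restr (sideF ends VH F) z x) (restr (sideF ends VH F) z y)
          (restr (sideF ends VH F) z w) := by
  rw [K3_eq_KB, st_eq_glued2B ends o a₁ a₂ a₃ b c d h hx, st_eq_glued2B ends o a₁ a₂ a₃ b c d h hy,
    st_eq_glued2B ends o a₁ a₂ a₃ b c d h hw]
  unfold farK rootK2B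
  rw [withinRestr_restr_eq ends VH hx, withinRestr_restr_eq ends VH hy,
    withinRestr_restr_eq ends VH hw, withinRestr_restr_eq ends VL hx,
    withinRestr_restr_eq ends VL hy, withinRestr_restr_eq ends VL hw]
  set hx' := rootData2B ends o a₁ a₂ a₃ c d (withinRestr ends VH x) with hhx
  set hy' := rootData2B ends o a₁ a₂ a₃ c d (withinRestr ends VH y) with hhy
  set hw' := rootData2B ends o a₁ a₂ a₃ c d (withinRestr ends VH w) with hhw
  set qx := fp ends c d b (withinRestr ends VL x) with hqx
  set qy := fp ends c d b (withinRestr ends VL y) with hqy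
  set qw := fp ends c d b (withinRestr ends VL w) with hqw
  have hs : (∑ p : Pat3, exact2 p.1 qx * exact2 p.2.1 qy * exact2 p.2.2 qw *
      KB (glued2B hx' p.1) (glued2B hy' p.2.1) (glued2B hw' p.2.2)) =
      KB (glued2B hx' qx) (glued2B hy' qy) (glued2B hw' qw) :=
    sum_exact2 (fun p : Pat3 => KB (glued2B hx' p.1) (glued2B hy' p.2.1) (glued2B hw' p.2.2))
      (qx, qy, qw)
  rw [← hs]
  push_cast
  rfl

omit [LinearOrder R] [IsStrictOrderedRing R] in
/-- **THE TYPED ONE-FAR-`b` RULE AT A 2-SEPARATOR**: sorting the copies by their far-pattern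
triple, `typedCount F z τ K₃ = (Σ_p farCount(p) · rootCount(p)) · (inert count)`. -/
theorem typedCount_eq_sep2FarB {VL VH : Set V} (F : Finset E) (z : Config E) (τ : E → ℕ)
    (h : Sep2FarB ends o a₁ a₂ a₃ b c d VL VH F z) :
    typedCount F z τ (K3 ends o a₁ a₂ a₃ b : Config E → Config E → Config E → R) =
      (∑ p : Pat3, typedCount (sideF ends VL F) z τ (farK ends c d b VL p) *
          typedCount (sideF ends VH F) z τ (rootK2B ends o a₁ a₂ a₃ c d VH p)) *
        typedCount (F \ (sideF ends VL F ∪ sideF ends VH F)) z τ (fun _ _ _ => (1 : R)) := by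
  set A := sideF ends VL F with hA
  set B := sideF ends VH F with hB
  set C := F \ (A ∪ B) with hC
  have hAF : A ⊆ F := Finset.filter_subset _ _
  have hBF : B ⊆ F := Finset.filter_subset _ _
  have hAB : Disjoint A B := by
    rw [Finset.disjoint_left]
    intro e heA heB
    simp only [hA, hB, sideF, Finset.mem_filter] at heA heB
    exact h.noloop e heA.1 ⟨heA.2, heB.2⟩
  have hABF : A ∪ B ⊆ F := Finset.union_subset hAF hBF
  have hAC : Disjoint A C :=
    Finset.disjoint_of_subset_left Finset.subset_union_left Finset.disjoint_sdiff
  have hBC : Disjoint B C :=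
    Finset.disjoint_of_subset_left Finset.subset_union_right Finset.disjoint_sdiff
  have hF : A ∪ B ∪ C = F := Finset.union_sdiff_of_subset hABF
  have hker : typedCount F z τ (K3 ends o a₁ a₂ a₃ b : Config E → Config E → Config E → R) =
      typedCount F z τ (fun x y w => ∑ p : Pat3,
        farK ends c d b VL p (restr A z x) (restr A z y) (restr A z w) *
          rootK2B ends o a₁ a₂ a₃ c d VH p (restr B z x) (restr B z y) (restr B z w)) := by
    refine typedCount_congr_on_support F z τ fun x y w hc _ => ?_
    exact K3_eq_sep2FarB ends o a₁ a₂ a₃ b c d h (fun e he => (hc e he).1)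
      (fun e he => (hc e he).2.1) (fun e he => (hc e he).2.2)
  have hm : ∀ p : Pat3, typedCount (A ∪ B ∪ C) z τ (fun x y w =>
      farK ends c d b VL p (restr A z x) (restr A z y) (restr A z w) *
        rootK2B ends o a₁ a₂ a₃ c d VH p (restr B z x) (restr B z y) (restr B z w)) =
      typedCount A z τ (farK ends c d b VL p) *
        typedCount B z τ (rootK2B ends o a₁ a₂ a₃ c d VH p) *
        typedCount C z τ (fun _ _ _ => (1 : R)) := fun p =>
    typedCount_mul_three A B C hAB hAC hBC z τ (farK ends c d b VL p)
      (rootK2B ends o a₁ a₂ a₃ c d VH p : Config E → Config E → Config E → R)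
  rw [hF] at hm
  rw [hker, typedCount_sum, Finset.sum_congr rfl (fun p _ => hm p), Finset.sum_mul]

/-- The `S₃`-orbit sum of the root-side counts of a pattern triple (the six copy permutations). -/
noncomputable def orbitRoot2B (VH : Set V) (B : Finset E) (z : Config E) (τ : E → ℕ)
    (p : Pat3) : R :=
  typedCount B z τ (rootK2B ends o a₁ a₂ a₃ c d VH p) +
    typedCount B z τ (rootK2B ends o a₁ a₂ a₃ c d VH (p.2.1, p.1, p.2.2)) +
    typedCount B z τ (rootK2B ends o a₁ a₂ a₃ c d VH (p.1, p.2.2, p.2.1)) +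
    typedCount B z τ (rootK2B ends o a₁ a₂ a₃ c d VH (p.2.2, p.2.1, p.1)) +
    typedCount B z τ (rootK2B ends o a₁ a₂ a₃ c d VH (p.2.1, p.2.2, p.1)) +
    typedCount B z τ (rootK2B ends o a₁ a₂ a₃ c d VH (p.2.2, p.1, p.2.1))

omit [LinearOrder R] [IsStrictOrderedRing R] in
/-- Pairing the far counts with a permuted root count gives the same sum (the far counts are
copy-symmetric, the permutation a bijection of the pattern triples). -/
lemma sum_far_root_permB (VL VH : Set V) (A B : Finset E) (z : Config E) (τ : E → ℕ)
    (f : Pat3 → Pat3) (hf : Function.Bijective f)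
    (hσ : ∀ p, typedCount A z τ (farK ends c d b VL (f p) : Config E → Config E → Config E → R) =
      typedCount A z τ (farK ends c d b VL p)) :
    (∑ p : Pat3, typedCount A z τ (farK ends c d b VL p : Config E → Config E → Config E → R) *
        typedCount B z τ (rootK2B ends o a₁ a₂ a₃ c d VH (f p))) =
      ∑ p : Pat3, typedCount A z τ (farK ends c d b VL p : Config E → Config E → Config E → R) *
        typedCount B z τ (rootK2B ends o a₁ a₂ a₃ c d VH p) := by
  refine Fintype.sum_bijective f hf _ _ fun p => ?_
  rw [hσ p]

/-- **Row 2′TRI when `b` sits alone behind a 2-separator** follows from the nonnegativity of the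
`S₃`-orbit sums of the root-side counts on the real pattern triples (the five set partitions of `{c, d, m}` per copy, `TwoSepReal.FPreal`). -/
theorem typedCount_nonneg_of_sep2FarB {VL VH : Set V} (F : Finset E) (z : Config E) (τ : E → ℕ)
    (hτ : ∀ e ∈ F, τ e = 1 ∨ τ e = 2) (h : Sep2FarB ends o a₁ a₂ a₃ b c d VL VH F z)
    (hroot : ∀ p : Pat3, FPreal p.1 → FPreal p.2.1 → FPreal p.2.2 →
      (0 : R) ≤ orbitRoot2B ends o a₁ a₂ a₃ c d VH (sideF ends VH F) z τ p) :
    0 ≤ typedCount F z τ (K3 ends o a₁ a₂ a₃ b : Config E → Config E → Config E → R) := by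
  rw [typedCount_eq_sep2FarB ends o a₁ a₂ a₃ b c d F z τ h]
  set A := sideF ends VL F with hA
  set B := sideF ends VH F with hB
  have hτA : ∀ e ∈ A, τ e = 1 ∨ τ e = 2 := fun e he => hτ e (Finset.filter_subset _ _ he)
  have hI : (0 : R) ≤ typedCount (F \ (A ∪ B)) z τ (fun _ _ _ => (1 : R)) :=
    typedCount_nonneg_of_nonneg _ _ _ fun _ _ _ => zero_le_one
  refine mul_nonneg ?_ hI
  set S : R := ∑ p : Pat3, typedCount A z τ (farK ends c d b VL p) *
    typedCount B z τ (rootK2B ends o a₁ a₂ a₃ c d VH p) with hS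
  have h6 : (6 : R) * S = ∑ p : Pat3, typedCount A z τ (farK ends c d b VL p) *
      orbitRoot2B ends o a₁ a₂ a₃ c d VH B z τ p := by
    unfold orbitRoot2B
    simp only [mul_add, Finset.sum_add_distrib]
    have hb12 : Function.Bijective (fun p : Pat3 => (p.2.1, p.1, p.2.2)) :=
      Function.Involutive.bijective fun _ => rfl
    have hb23 : Function.Bijective (fun p : Pat3 => (p.1, p.2.2, p.2.1)) :=
      Function.Involutive.bijective fun _ => rfl
    have hb13 : Function.Bijective (fun p : Pat3 => (p.2.2, p.2.1, p.1)) :=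
      Function.Involutive.bijective fun _ => rfl
    have hbc : Function.Bijective (fun p : Pat3 => (p.2.1, p.2.2, p.1)) :=
      Function.bijective_iff_has_inverse.mpr
        ⟨fun p => (p.2.2, p.1, p.2.1), fun _ => rfl, fun _ => rfl⟩
    have hbc' : Function.Bijective (fun p : Pat3 => (p.2.2, p.1, p.2.1)) :=
      Function.bijective_iff_has_inverse.mpr
        ⟨fun p => (p.2.1, p.2.2, p.1), fun _ => rfl, fun _ => rfl⟩
    rw [sum_far_root_permB ends o a₁ a₂ a₃ b c d VL VH A B z τ _ hb12
        (fun p => farCount_swap12 ends c d b VL A z τ p),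
      sum_far_root_permB ends o a₁ a₂ a₃ b c d VL VH A B z τ _ hb23
        (fun p => farCount_swap23 ends c d b VL A z τ hτA p),
      sum_far_root_permB ends o a₁ a₂ a₃ b c d VL VH A B z τ _ hb13
        (fun p => farCount_swap13 ends c d b VL A z τ hτA p),
      sum_far_root_permB ends o a₁ a₂ a₃ b c d VL VH A B z τ _ hbc
        (fun p => farCount_cyc ends c d b VL A z τ hτA p),
      sum_far_root_permB ends o a₁ a₂ a₃ b c d VL VH A B z τ _ hbc'
        (fun p => farCount_cyc' ends c d b VL A z τ hτA p)]
    rw [hS]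
    ring
  have hpos : (0 : R) ≤ ∑ p : Pat3, typedCount A z τ (farK ends c d b VL p) *
      orbitRoot2B ends o a₁ a₂ a₃ c d VH B z τ p := by
    refine Finset.sum_nonneg fun p _ => ?_
    by_cases hok : FPreal p.1 ∧ FPreal p.2.1 ∧ FPreal p.2.2
    · exact mul_nonneg (farCount_nonneg ends c d b VL A z τ p) (hroot p hok.1 hok.2.1 hok.2.2)
    · have hz : typedCount A z τ (farK ends c d b VL p : Config E → Config E → Config E → R) = 0 := by
        refine farCount_eq_zero_of_not_real ends c d b VL A z τ p ?_
        by_cases h1 : FPreal p.1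
        · by_cases h2 : FPreal p.2.1
          · by_cases h3 : FPreal p.2.2
            · exact absurd ⟨h1, h2, h3⟩ hok
            · exact Or.inr (Or.inr h3)
          · exact Or.inr (Or.inl h2)
        · exact Or.inl h1
      rw [hz, zero_mul]
  rw [← h6] at hpos
  exact (mul_nonneg_iff_of_pos_left (by norm_num : (0 : R) < 6)).mp hpos

end Main

end RootBridge

end CovForm

end Summit.Ventures.PercRepro2
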